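import Literature.AnabelianGeometry.Anabelioids.FibreTrivializedProducts
import Literature.AnabelianGeometry.Anabelioids.ExactFunctorProofs
import Literature.AnabelianGeometry.SemiGraphs.BoundedOrderCoveringProofs
import Literature.AnabelianGeometry.SemiGraphs.CommensurabilityProofs4
import Literature.AnabelianGeometry.SemiGraphs.CoverticialVertexCaseTools
import Literature.AnabelianGeometry.SemiGraphs.GraphOfAnabelioidsGalois
import Literature.AnabelianGeometry.SemiGraphs.PullbackFunctor
import Literature.AnabelianGeometry.SemiGraphs.SingleVertexSubgraph
import HarnessLib

/-!
# [SemiAnbd] Proposition 2.5 (i) (Injectivity) — proof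

Mochizuki, *Semi-graphs of anabelioids*, Publ. RIMS **42** (2006) 221–322, §2, Proposition 2.5 (i),
author's manuscript p. 27 (PRIMS pp. 249–250) [cite: MochizukiSemiAnbd2006, Prop. 2.5(i) p.27]:
for a connected, quasi-coherent graph of anabelioids `𝒢` and a connected subgraph `ℍ`, "the natural
morphisms `Π_b → Π_𝒢`, `Π_v → Π_𝒢`, `Π_ℍ → Π_𝒢` are injective".  This proof-only companion of
abc-iut-L3-t1's `Commensurability.lean` DISCHARGES the named fact `proposition_2_5_i` (all three
clauses, `proposition_2_5_i_holds`).

The printed proof: "it suffices to show that any finite étale [Galois] covering of `𝒢_ℍ` may be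
split by a finite étale covering pulled back from `𝒢` … immediate in the locally trivial case
[extend … by gluing] … Thus, by our assumption of quasi-coherence, it suffices to construct, under the
further assumption that `𝒢` is of bounded order, a finite étale covering of `𝒢` each of whose
constituent anabelioids is trivial" (that covering is abc-iut-L6-t18's `exists_boundedOrderCovering`).
In t1's descent-datum model `B(𝒢)` (objects = vertex/edge objects with BRANCHWISE gluing
isomorphisms, no cocycle condition) the argument becomes, for `σ ∈ Π_ℍ` dying in `Π_𝒢` and an
object `Y ∈ B(𝒢_ℍ)` (`piHToPi_injective`):

1. quasi-coherence yields an approximator `φ : 𝒢 → 𝒢'` splitting the kernels of the fibre actions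
   of the constituents `Y_c`, `c ∈ ℍ`; `X := φ^* A'` for the bounded-order covering `A'` of `𝒢'`;
   then over every `c ∈ ℍ` the stabilisers of the (free-modulo-kernel) fibre of `X_c` act trivially
   on the fibre of `Y_c`, whence a trivialisation `θ_c : D_c ⨯ X_c ≅ Y_c ⨯ X_c` with `D_c` constant
   (`Anabelioids/FibreTrivializedProducts.lean`) — "`X` splits `Y` locally";
2. the object `W := (D_c ⨯ X_c)_c ∈ B(𝒢)`, glued along the branches of `ℍ` through the `θ_c` and the
   gluing of `Y ⨯ X|_ℍ`, and trivially elsewhere — the extension "by gluing" of `Y ⨯ X|_ℍ` to `𝒢`;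
3. the projection `W|_ℍ → Y` is surjective on the fibre at the base vertex while `σ` acts trivially
   on `W|_ℍ`; hence `σ` acts trivially on `Y`, i.e. `σ = 1`.

The vertex clause is the case `ℍ = {v}` (t1's `SingleVertexSubgraph.lean`: `ρ_v : B(𝒢_{{v}}) ⥤ 𝒢_v`
is an equivalence), the branch clause follows by injective type.  abc-iut-L3-d6's unfiled draft of
the vertex clause (2026-08-25) was read for orientation; nothing unaccepted is imported.  Theorems
only; nothing here concerns [IUTchIII] Cor. 3.12.  Seat abc-iut-w4-d063 (L3 sub-node (13)).
-/

namespace Literature.AnabelianGeometry.SemiGraphs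

namespace SemiGraphOfAnabelioids

open CategoryTheory CategoryTheory.Limits CategoryTheory.PreGaloisCategory
open Literature.AnabelianGeometry.Anabelioids

universe v₁ u₁ u

variable {𝒢 : SemiGraphOfAnabelioids.{v₁, u₁, u}}

/-- An approximator of a graph of anabelioids has a graph as target: every edge of `𝒢'` has an
abutting branch (image of an abutting branch of the corresponding edge of `𝒢`).
[cite: MochizukiSemiAnbd2006, Def. 2.3(ii) p.25] -/
theorem exists_abutting_of_isApproximator (hgr : 𝒢.IsGraphOfAnabelioids)
    {𝒢' : SemiGraphOfAnabelioids.{v₁, u₁, u}} (φ : Hom 𝒢 𝒢') (happ : φ.IsApproximator)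
    (e' : 𝒢'.graph.Edge) :
    ∃ (b' : 𝒢'.graph.Branch) (w' : 𝒢'.graph.Vertex),
      𝒢'.graph.edgeOf b' = e' ∧ 𝒢'.graph.abuts b' = some w' := by
  haveI := happ.isIso_base
  obtain ⟨b, -, -, hb, -, -⟩ := 𝒢.graph.two_branches ((inv φ.base).edgeMap e')
  obtain ⟨w, hw⟩ := Option.isSome_iff_exists.mp (hgr.isGraph.abuts_isSome b)
  refine ⟨φ.base.branchMap b, φ.base.vertexMap w, ?_, φ.base.abuts_branchMap b w hw⟩
  rw [φ.base.edgeOf_branchMap, hb]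
  change (inv φ.base ≫ φ.base).edgeMap e' = e'
  rw [IsIso.inv_hom_id]
  rfl

/-- The coincidence map of `ℍ` at a branch of `ℍ` abutting to a vertex of `ℍ` ([SemiAnbd] §1 p. 12).
[cite: MochizukiSemiAnbd2006, §1 p.12] -/
theorem abuts_toSemiGraph (H : 𝒢.graph.Subgraph) {b : 𝒢.graph.Branch}
    (hb : 𝒢.graph.edgeOf b ∈ H.edges) {v : 𝒢.graph.Vertex} (hv : v ∈ H.verts)
    (h : 𝒢.graph.abuts b = some v) :
    H.toSemiGraph.abuts ⟨b, hb⟩ = some ⟨v, hv⟩ := by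
  classical
  dsimp only [SemiGraph.Subgraph.toSemiGraph]
  rw [h, Option.pbind_some, dif_pos hv]

/-- **[SemiAnbd] Proposition 2.5 (i), the clause `Π_ℍ ↪ Π_𝒢`** (p. 27): for a quasi-coherent graph
of anabelioids `𝒢` and a connected sub-semi-graph `ℍ` (print: a subgraph; that `ℍ` be a graph is
not needed), the natural homomorphism `Π_ℍ → Π_𝒢` (basepoints through a vertex `w` of `ℍ`) is
injective.  Proof as in the module docstring: every `σ` in the kernel
acts trivially on the fibre of every `Y ∈ B(𝒢_ℍ)`, via the extension `W ∈ B(𝒢)` of `Y ⨯ X|_ℍ` for the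
pull-back `X` of the bounded-order covering of an approximator splitting the constituents of `Y`.
(Connectedness of `𝒢` itself is not needed.) [cite: MochizukiSemiAnbd2006, Prop. 2.5(i) p.27] -/
theorem piHToPi_injective (hgr : 𝒢.IsGraphOfAnabelioids) (hqc : 𝒢.IsQuasiCoherent)
    (H : 𝒢.graph.Subgraph) (hHc : H.toSemiGraph.IsConnected)
    (w : H.toSemiGraph.Vertex) (F : 𝒢.V w.1 ⥤ FintypeCat.{v₁}) [FiberFunctor F] :
    Function.Injective (𝒢.piHToPi H w F) := by
  classical
  -- `B(𝒢_ℍ)` is a Galois category with basepoint `ρ_w ⋙ F`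
  letI := (𝒢.restrict H).preGaloisCategory_bObj
  have hcH : (𝒢.restrict H).IsConnected := ⟨hHc⟩
  haveI : GaloisCategory (𝒢.restrict H).BObj := (𝒢.restrict H).galoisCategory_bObj hcH
  haveI : @FiberFunctor ((𝒢.restrict H).V w) ((𝒢.restrict H).catV w)
      ((𝒢.restrict H).galV w).toPreGaloisCategory F := ‹FiberFunctor F›
  haveI : FiberFunctor ((𝒢.restrict H).ρ w ⋙ F) := (𝒢.restrict H).fiberFunctor_ρ hcH w F
  rw [injective_iff_map_eq_one]
  intro σ hσ
  suffices hY : ∀ Y : (𝒢.restrict H).BObj, σ.hom.app Y = 𝟙 _ by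
    apply Iso.ext
    apply NatTrans.ext
    funext Y
    exact hY Y
  intro Y
  -- the constituents of `Y`, re-keyed as objects of the constituents of `𝒢`
  let YS : ∀ vH : H.toSemiGraph.Vertex, 𝒢.V vH.1 := fun vH => Y.S vH
  let YT : ∀ eH : H.toSemiGraph.Edge, 𝒢.E eH.1 := fun eH => Y.T eH
  let Yψ : ∀ (bH : H.toSemiGraph.Branch) (vH : H.toSemiGraph.Vertex)
      (hH : H.toSemiGraph.abuts bH = some vH),
      (𝒢.pull bH.1 vH.1 (H.ι.abuts_branchMap bH vH hH)).pullback.obj (YS vH) ≅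
        YT (H.toSemiGraph.edgeOf bH) := fun bH vH hH => Y.ψ bH vH hH
  -- chosen basepoints of all the constituents of `𝒢`
  let F₀ : ∀ v : 𝒢.graph.Vertex, 𝒢.V v ⥤ FintypeCat.{v₁} :=
    fun v => GaloisCategory.getFiberFunctor (𝒢.V v)
  let E₀ : ∀ e : 𝒢.graph.Edge, 𝒢.E e ⥤ FintypeCat.{v₁} :=
    fun e => GaloisCategory.getFiberFunctor (𝒢.E e)
  -- the fibre cardinality of `Y`, the same at every constituent of the connected `ℍ`
  let n : ℕ := Nat.card (F.obj (YS w))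
  have hcardV : ∀ vH : H.toSemiGraph.Vertex, Nat.card ((F₀ vH.1).obj (YS vH)) = n := by
    intro vH
    haveI : @FiberFunctor ((𝒢.restrict H).V vH) ((𝒢.restrict H).catV vH)
        ((𝒢.restrict H).galV vH).toPreGaloisCategory (F₀ vH.1) :=
      (inferInstance : FiberFunctor (GaloisCategory.getFiberFunctor (𝒢.V vH.1)))
    haveI : FiberFunctor ((𝒢.restrict H).ρ vH ⋙ F₀ vH.1) :=
      (𝒢.restrict H).fiberFunctor_ρ hcH vH (F₀ vH.1)
    obtain ⟨i⟩ := nonempty_iso_of_fiberFunctor' ((𝒢.restrict H).ρ vH ⋙ F₀ vH.1)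
      ((𝒢.restrict H).ρ w ⋙ F)
    exact card_fiber_eq_of_iso_fiberFunctor i Y
  have hcardE : ∀ eH : H.toSemiGraph.Edge, Nat.card ((E₀ eH.1).obj (YT eH)) = n := by
    intro eH
    haveI : @FiberFunctor ((𝒢.restrict H).E eH) ((𝒢.restrict H).catE eH)
        ((𝒢.restrict H).galE eH).toPreGaloisCategory (E₀ eH.1) :=
      (inferInstance : FiberFunctor (GaloisCategory.getFiberFunctor (𝒢.E eH.1)))
    haveI : FiberFunctor ((𝒢.restrict H).ρE eH ⋙ E₀ eH.1) :=
      (𝒢.restrict H).fiberFunctor_ρE hcH eH (E₀ eH.1)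
    obtain ⟨i⟩ := nonempty_iso_of_fiberFunctor' ((𝒢.restrict H).ρE eH ⋙ E₀ eH.1)
      ((𝒢.restrict H).ρ w ⋙ F)
    exact card_fiber_eq_of_iso_fiberFunctor i Y
  -- the covering collection: kernels of the fibre actions of `Y` over `ℍ`, trivial elsewhere
  have hn1 : 1 ≤ n.factorial := Nat.succ_le_of_lt (Nat.factorial_pos n)
  have hKV : ∀ v : 𝒢.graph.Vertex, ∃ K : Subgroup (Aut (F₀ v)), IsOpen (K : Set (Aut (F₀ v))) ∧
      K.index ≤ n.factorial ∧ ∀ (hv : v ∈ H.verts) (τ : Aut (F₀ v)), τ ∈ K →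
        ∀ y : (F₀ v).obj (YS ⟨v, hv⟩), τ • y = y := by
    intro v
    by_cases hv : v ∈ H.verts
    · obtain ⟨K, hKo, hKi, hKm⟩ := exists_fiberActionKernel (F₀ v) (YS ⟨v, hv⟩)
      refine ⟨K, hKo, ?_, fun _ τ hτ y => (hKm τ).mp hτ y⟩
      rw [hcardV ⟨v, hv⟩] at hKi
      exact hKi
    · refine ⟨⊤, ?_, ?_, fun hv' => absurd hv' hv⟩
      · rw [Subgroup.coe_top]; exact isOpen_univ
      · rw [Subgroup.index_top]; exact hn1
  choose KV hKVo hKVi hKVm using hKV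
  have hKE : ∀ e : 𝒢.graph.Edge, ∃ K : Subgroup (Aut (E₀ e)), IsOpen (K : Set (Aut (E₀ e))) ∧
      K.index ≤ n.factorial ∧ ∀ (he : e ∈ H.edges) (τ : Aut (E₀ e)), τ ∈ K →
        ∀ y : (E₀ e).obj (YT ⟨e, he⟩), τ • y = y := by
    intro e
    by_cases he : e ∈ H.edges
    · obtain ⟨K, hKo, hKi, hKm⟩ := exists_fiberActionKernel (E₀ e) (YT ⟨e, he⟩)
      refine ⟨K, hKo, ?_, fun _ τ hτ y => (hKm τ).mp hτ y⟩
      rw [hcardE ⟨e, he⟩] at hKi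
      exact hKi
    · refine ⟨⊤, ?_, ?_, fun he' => absurd he' he⟩
      · rw [Subgroup.coe_top]; exact isOpen_univ
      · rw [Subgroup.index_top]; exact hn1
  choose KE hKEo hKEi hKEm using hKE
  let 𝒞 : CoveringCollection 𝒢 n.factorial :=
    { FV := F₀
      fiberV := fun v => inferInstance
      FE := E₀
      fiberE := fun e => inferInstance
      UV := KV
      UE := KE
      isOpen_UV := hKVo
      isOpen_UE := hKEo
      index_UV := hKVi
      index_UE := hKEi }
  obtain ⟨𝒢', φ, happ, hsplit⟩ := hqc.exists_approximator _ hn1 𝒞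
  -- the bounded-order covering `A'` of `𝒢'` and its pull-back `X`
  obtain ⟨M', hM'1, hM'⟩ := happ.isOfBoundedOrder.exists_bound
  obtain ⟨A', hA'V, hA'E⟩ :=
    exists_boundedOrderCovering 𝒢' happ.isOfBoundedOrder.isOfInjectiveType hM'1 hM'
  have hA'E' : ∀ (e' : 𝒢'.graph.Edge) (Φ : 𝒢'.E e' ⥤ FintypeCat.{v₁}) [FiberFunctor Φ],
      (∀ (σ : Aut Φ) (x : Φ.obj (A'.T e')), σ • x = x → σ = 1) ∧ Nat.card (Φ.obj (A'.T e')) = M' := by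
    intro e' Φ _
    obtain ⟨b', v', rfl, hb'⟩ := exists_abutting_of_isApproximator hgr φ happ e'
    exact hA'E b' v' hb' Φ
  let X : 𝒢.BObj := φ.pullbackFunctor.obj A'
  -- pull-back functors are exact
  have instL : ∀ (b : 𝒢.graph.Branch) (v : 𝒢.graph.Vertex) (h : 𝒢.graph.abuts b = some v),
      PreservesFiniteLimits (𝒢.pull b v h).pullback := fun b v h => (𝒢.pull b v h).property.1
  have instC : ∀ (b : 𝒢.graph.Branch) (v : 𝒢.graph.Vertex) (h : 𝒢.graph.abuts b = some v),
      PreservesFiniteColimits (𝒢.pull b v h).pullback := fun b v h => (𝒢.pull b v h).property.2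
  -- fibres of `X`: free modulo the kernel of the approximator, and nonempty
  have hXV : ∀ (v : 𝒢.graph.Vertex) (τ : Aut (F₀ v)) (x : (F₀ v).obj (X.S v)), τ • x = x →
      pi1Map (φ.φV v).pullback (F₀ v) τ = 1 := by
    intro v τ x hx
    haveI : PreservesFiniteLimits (φ.φV v).pullback := (φ.φV v).property.1
    haveI : PreservesFiniteColimits (φ.φV v).pullback := (φ.φV v).property.2
    haveI : FiberFunctor ((φ.φV v).pullback ⋙ F₀ v) := fiberFunctor_comp_of_exact _ _
    exact (hA'V (φ.base.vertexMap v) ((φ.φV v).pullback ⋙ F₀ v)).1 (pi1Map (φ.φV v).pullback (F₀ v) τ)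
      x hx
  have hXE : ∀ (e : 𝒢.graph.Edge) (τ : Aut (E₀ e)) (x : (E₀ e).obj (X.T e)), τ • x = x →
      pi1Map (φ.φE e (φ.base.edgeMap e) rfl).pullback (E₀ e) τ = 1 := by
    intro e τ x hx
    haveI : PreservesFiniteLimits (φ.φE e (φ.base.edgeMap e) rfl).pullback :=
      (φ.φE e (φ.base.edgeMap e) rfl).property.1
    haveI : PreservesFiniteColimits (φ.φE e (φ.base.edgeMap e) rfl).pullback :=
      (φ.φE e (φ.base.edgeMap e) rfl).property.2
    haveI : FiberFunctor ((φ.φE e (φ.base.edgeMap e) rfl).pullback ⋙ E₀ e) :=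
      fiberFunctor_comp_of_exact _ _
    exact (hA'E' (φ.base.edgeMap e) ((φ.φE e (φ.base.edgeMap e) rfl).pullback ⋙ E₀ e)).1
      (pi1Map _ (E₀ e) τ) x hx
  -- constant objects of fibre cardinality `n`
  have hD : ∀ v : 𝒢.graph.Vertex, ∃ D : 𝒢.V v, ∀ (Φ : 𝒢.V v ⥤ FintypeCat.{v₁}) [FiberFunctor Φ],
      (∀ (τ : Aut Φ) (d : Φ.obj D), τ • d = d) ∧ Nat.card (Φ.obj D) = n := fun v => by
    obtain ⟨D, -, h⟩ := exists_trivial_card_eq (F₀ v) n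
    exact ⟨D, h⟩
  choose D hD using hD
  have hDE : ∀ e : 𝒢.graph.Edge, ∃ D : 𝒢.E e, ∀ (Φ : 𝒢.E e ⥤ FintypeCat.{v₁}) [FiberFunctor Φ],
      (∀ (τ : Aut Φ) (d : Φ.obj D), τ • d = d) ∧ Nat.card (Φ.obj D) = n := fun e => by
    obtain ⟨D, -, h⟩ := exists_trivial_card_eq (E₀ e) n
    exact ⟨D, h⟩
  choose DE hDE using hDE
  -- gluing of the constant objects along every branch
  have hκ : ∀ (b : 𝒢.graph.Branch) (v : 𝒢.graph.Vertex) (h : 𝒢.graph.abuts b = some v),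
      Nonempty ((𝒢.pull b v h).pullback.obj (D v) ≅ DE (𝒢.graph.edgeOf b)) := by
    intro b v h
    haveI := instL b v h
    haveI := instC b v h
    haveI : FiberFunctor ((𝒢.pull b v h).pullback ⋙ E₀ (𝒢.graph.edgeOf b)) :=
      fiberFunctor_comp_of_exact _ _
    obtain ⟨h1, h2⟩ := hD v ((𝒢.pull b v h).pullback ⋙ E₀ (𝒢.graph.edgeOf b))
    obtain ⟨h3, h4⟩ := hDE (𝒢.graph.edgeOf b) (E₀ (𝒢.graph.edgeOf b))
    exact nonempty_iso_of_trivial (E₀ _) (trivial_comp (E₀ _) (𝒢.pull b v h).pullback h1) h3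
      (h2.trans h4.symm)
  -- the local trivialisations over the constituents of `ℍ` ("`X` splits `Y`")
  have hθV : ∀ vH : H.toSemiGraph.Vertex,
      Nonempty (D vH.1 ⨯ X.S vH.1 ≅ YS vH ⨯ X.S vH.1) := by
    intro vH
    obtain ⟨hDt, hDc⟩ := hD vH.1 (F₀ vH.1)
    refine nonempty_iso_prod_of_stabilizer (F₀ vH.1) hDt (hDc.trans (hcardV vH).symm) ?_
    intro τ x hx y
    have h2 : τ ∈ KV vH.1 := hsplit.1 vH.1 ((MonoidHom.mem_ker).mpr (hXV vH.1 τ x hx))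
    exact hKVm vH.1 vH.2 τ h2 y
  have hθE : ∀ eH : H.toSemiGraph.Edge,
      Nonempty (DE eH.1 ⨯ X.T eH.1 ≅ YT eH ⨯ X.T eH.1) := by
    intro eH
    obtain ⟨hDt, hDc⟩ := hDE eH.1 (E₀ eH.1)
    refine nonempty_iso_prod_of_stabilizer (E₀ eH.1) hDt (hDc.trans (hcardE eH).symm) ?_
    intro τ x hx y
    have h2 : τ ∈ KE eH.1 := hsplit.2 eH.1 ((MonoidHom.mem_ker).mpr (hXE eH.1 τ x hx))
    exact hKEm eH.1 eH.2 τ h2 y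
  let κ : ∀ (b : 𝒢.graph.Branch) (v : 𝒢.graph.Vertex) (h : 𝒢.graph.abuts b = some v),
      (𝒢.pull b v h).pullback.obj (D v) ≅ DE (𝒢.graph.edgeOf b) := fun b v h => (hκ b v h).some
  let θV : ∀ vH : H.toSemiGraph.Vertex, D vH.1 ⨯ X.S vH.1 ≅ YS vH ⨯ X.S vH.1 :=
    fun vH => (hθV vH).some
  let θE : ∀ eH : H.toSemiGraph.Edge, DE eH.1 ⨯ X.T eH.1 ≅ YT eH ⨯ X.T eH.1 :=
    fun eH => (hθE eH).some
  -- the object `W ∈ B(𝒢)`: `D_c ⨯ X_c` everywhere, glued through `Y` along the branches of `ℍ`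
  let ψW : ∀ (b : 𝒢.graph.Branch) (v : 𝒢.graph.Vertex) (h : 𝒢.graph.abuts b = some v),
      (𝒢.pull b v h).pullback.obj (D v ⨯ X.S v) ≅
        DE (𝒢.graph.edgeOf b) ⨯ X.T (𝒢.graph.edgeOf b) := fun b v h =>
    haveI := instL b v h
    if hb : 𝒢.graph.edgeOf b ∈ H.edges ∧ v ∈ H.verts then
      (𝒢.pull b v h).pullback.mapIso (θV ⟨v, hb.2⟩) ≪≫
        PreservesLimitPair.iso (𝒢.pull b v h).pullback (YS ⟨v, hb.2⟩) (X.S v) ≪≫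
        prod.mapIso (Yψ ⟨b, hb.1⟩ ⟨v, hb.2⟩ (abuts_toSemiGraph H hb.1 hb.2 h)) (X.ψ b v h) ≪≫
        (θE ⟨𝒢.graph.edgeOf b, hb.1⟩).symm
    else
      PreservesLimitPair.iso (𝒢.pull b v h).pullback (D v) (X.S v) ≪≫
        prod.mapIso (κ b v h) (X.ψ b v h)
  let W : 𝒢.BObj := ⟨fun v => D v ⨯ X.S v, fun e => DE e ⨯ X.T e, ψW⟩
  -- the projection `W|_ℍ ⟶ Y`
  let q : (𝒢.restrictFunctor H).obj W ⟶ Y :=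
    { fS := fun vH => show ((𝒢.restrictFunctor H).obj W).S vH ⟶ Y.S vH from
        ((θV vH).hom ≫ prod.fst : D vH.1 ⨯ X.S vH.1 ⟶ YS vH)
      fT := fun eH => show ((𝒢.restrictFunctor H).obj W).T eH ⟶ Y.T eH from
        ((θE eH).hom ≫ prod.fst : DE eH.1 ⨯ X.T eH.1 ⟶ YT eH)
      comm := fun bH vH hH => by
        haveI := instL bH.1 vH.1 (H.ι.abuts_branchMap bH vH hH)
        have hcond : 𝒢.graph.edgeOf bH.1 ∈ H.edges ∧ vH.1 ∈ H.verts := ⟨bH.2, vH.2⟩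
        -- the gluing of `W` along a branch of `ℍ` is the twisted one
        have hψ : (ψW bH.1 vH.1 (H.ι.abuts_branchMap bH vH hH)).hom =
            (𝒢.pull bH.1 vH.1 (H.ι.abuts_branchMap bH vH hH)).pullback.map (θV vH).hom ≫
              prodComparison (𝒢.pull bH.1 vH.1 (H.ι.abuts_branchMap bH vH hH)).pullback
                (YS vH) (X.S vH.1) ≫
              prod.map (Yψ bH vH hH).hom (X.ψ bH.1 vH.1 (H.ι.abuts_branchMap bH vH hH)).hom ≫
              (θE (H.toSemiGraph.edgeOf bH)).inv := by
          simp only [ψW, dif_pos hcond, Iso.trans_hom, Functor.mapIso_hom, Iso.symm_hom,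
            prod.mapIso_hom, PreservesLimitPair.iso_hom]
          rfl
        change ((𝒢.pull bH.1 vH.1 (H.ι.abuts_branchMap bH vH hH)).pullback.map
            ((θV vH).hom ≫ prod.fst) ≫ (Yψ bH vH hH).hom :
            (𝒢.pull bH.1 vH.1 (H.ι.abuts_branchMap bH vH hH)).pullback.obj (D vH.1 ⨯ X.S vH.1) ⟶
              YT (H.toSemiGraph.edgeOf bH)) =
          (ψW bH.1 vH.1 (H.ι.abuts_branchMap bH vH hH)).hom ≫ (θE (H.toSemiGraph.edgeOf bH)).hom ≫
            (prod.fst : YT (H.toSemiGraph.edgeOf bH) ⨯ X.T (H.toSemiGraph.edgeOf bH).1 ⟶ YT _)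
        rw [hψ, Functor.map_comp]
        erw [Category.assoc, Category.assoc, Category.assoc, Category.assoc, Iso.inv_hom_id_assoc,
          prod.map_fst, prodComparison_fst_assoc] }
  -- `σ` acts trivially on the fibre of `W|_ℍ` at `w` …
  have h1 : σ.hom.app ((𝒢.restrictFunctor H).obj W) = 𝟙 _ :=
    congrArg (fun τ : Aut (𝒢.restrictFunctor H ⋙ ((𝒢.restrict H).ρ w ⋙ F)) => τ.hom.app W) hσ
  -- … and the projection is surjective on the fibre at `w`
  have hmq : ((𝒢.restrict H).ρ w ⋙ F).map q = F.map ((θV w).hom ≫ prod.fst) := rfl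
  have hsurj : Function.Surjective (((𝒢.restrict H).ρ w ⋙ F).map q) := by
    rw [hmq, F.map_comp]
    haveI : PreservesFiniteLimits (φ.φV w.1).pullback := (φ.φV w.1).property.1
    haveI : PreservesFiniteColimits (φ.φV w.1).pullback := (φ.φV w.1).property.2
    haveI : FiberFunctor ((φ.φV w.1).pullback ⋙ F) := fiberFunctor_comp_of_exact _ _
    have hne : Nonempty (F.obj (X.S w.1)) := by
      have hc := (hA'V (φ.base.vertexMap w.1) ((φ.φV w.1).pullback ⋙ F)).2
      have : 0 < Nat.card (F.obj (X.S w.1)) := by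
        change 0 < Nat.card (((φ.φV w.1).pullback ⋙ F).obj (A'.S (φ.base.vertexMap w.1)))
        omega
      exact (Nat.card_pos_iff.mp this).1
    have hs2 : Function.Surjective (F.map (prod.fst : YS w ⨯ X.S w.1 ⟶ YS w)) :=
      map_prod_fst_surjective F hne
    have hs1 : Function.Surjective (F.map (θV w).hom) :=
      (ConcreteCategory.bijective_of_isIso (F.map (θV w).hom)).2
    intro y
    obtain ⟨z, rfl⟩ := hs2 y
    obtain ⟨t, rfl⟩ := hs1 z
    exact ⟨t, rfl⟩
  -- naturality of `σ` along `q`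
  apply FintypeCat.hom_ext
  intro y
  obtain ⟨z, rfl⟩ := hsurj y
  have hnat := σ.hom.naturality q
  rw [h1, Category.id_comp] at hnat
  have hz := ConcreteCategory.congr_hom hnat z
  rw [FintypeCat.comp_apply] at hz
  rw [FintypeCat.id_apply]
  exact hz

/-- **[SemiAnbd] Proposition 2.5 (i), the clause `Π_v ↪ Π_𝒢`** (p. 27: "the morphism `Π_v → Π_𝒢` may be
considered as a special case of the morphism `Π_ℍ → Π_𝒢` [i.e., the case where `ℍ` consists of a single
vertex and no edges]"): through t1's equivalence `ρ_v : B(𝒢_{{v}}) ⥤ 𝒢_v` (`SingleVertexSubgraph.lean`).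
[cite: MochizukiSemiAnbd2006, Prop. 2.5(i) p.27] -/
theorem piVToPi_injective (hgr : 𝒢.IsGraphOfAnabelioids) (hqc : 𝒢.IsQuasiCoherent)
    (v : 𝒢.graph.Vertex) (F : 𝒢.V v ⥤ FintypeCat.{v₁}) [FiberFunctor F] :
    Function.Injective (𝒢.piVToPi v F) := by
  have hcomp := piHToPi_comp_piVToPi 𝒢 ⟨{v}, ∅⟩ ⟨v, Set.mem_singleton v⟩ F
  haveI := single_ρ_isEquivalence 𝒢 v
  have hbij := pi1Map_bijective_of_isEquivalence
    ((𝒢.restrict ⟨{v}, ∅⟩).ρ ⟨v, Set.mem_singleton v⟩) F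
  have hH := piHToPi_injective hgr hqc ⟨{v}, ∅⟩ (single_isConnected 𝒢 v) ⟨v, Set.mem_singleton v⟩ F
  rw [← hcomp]
  exact hH.comp hbij.1

/-- **[SemiAnbd] Proposition 2.5 (i), the clause `Π_b ↪ Π_𝒢`** (p. 27: "since the natural morphism
`Π_b → Π_v` is injective" — injective type — composed with the vertex clause at the induced basepoint).
[cite: MochizukiSemiAnbd2006, Prop. 2.5(i) p.27] -/
theorem piBToPi_injective (hgr : 𝒢.IsGraphOfAnabelioids) (hqc : 𝒢.IsQuasiCoherent)
    (b : 𝒢.graph.Branch) (v : 𝒢.graph.Vertex) (h : 𝒢.graph.abuts b = some v)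
    (F : 𝒢.E (𝒢.graph.edgeOf b) ⥤ FintypeCat.{v₁}) [FiberFunctor F] :
    Function.Injective (𝒢.piBToPi b v h F) := by
  haveI : PreservesFiniteLimits (𝒢.pull b v h).pullback := (𝒢.pull b v h).property.1
  haveI : PreservesFiniteColimits (𝒢.pull b v h).pullback := (𝒢.pull b v h).property.2
  haveI : FiberFunctor ((𝒢.pull b v h).pullback ⋙ F) := fiberFunctor_comp_of_exact _ _
  exact (piVToPi_injective hgr hqc v ((𝒢.pull b v h).pullback ⋙ F)).comp
    (hqc.isOfInjectiveType.isPi1Mono b v h F)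

/-- **[SemiAnbd] Proposition 2.5 (i) (Injectivity)** — discharge of abc-iut-L3-t1's named fact
`proposition_2_5_i` (all three clauses; the hypotheses "connected" for `𝒢` and "graph" for `ℍ` of the
typed statement are not needed). [cite: MochizukiSemiAnbd2006, Prop. 2.5(i) p.27] -/
theorem proposition_2_5_i_holds :
    Literature.AnabelianGeometry.SemiGraphs.SemiGraphOfAnabelioids.proposition_2_5_i.{v₁, u₁, u} :=
  fun _ _ hgr hqc =>
    ⟨fun b v h F _ => piBToPi_injective hgr hqc b v h F,
      fun v F _ => piVToPi_injective hgr hqc v F,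
      fun H hHc _ w F _ => piHToPi_injective hgr hqc H hHc w F⟩

end SemiGraphOfAnabelioids

end Literature.AnabelianGeometry.SemiGraphs
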